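import Summits.RiemannHypothesis.RiemannHypothesis.Theorems.WeilFormatCEntry
import Summits.RiemannHypothesis.RiemannHypothesis.Theorems.WeilFormatCWindowGram
import Literature.NumberTheory.LFunctions.YoshidaWindowGram
import HarnessLib

/-!
# Format C — the bridge between the two Gram packagings: `weilWindowSesq a χ_m χ_n = gramCoeff a m n`

Helper file of the rh-explicit Weil-positivity programme (`--supports stmt-RiemannHypothesis-0098`; seat
rh-explicit-weil-2), RH-free, no definitions, no named facts.

weil-3's `WeilFormatCDefs/WindowSesq/WindowGram.lean` package the format-C interface through the SESQUILINEAR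
window form `weilWindowSesq a u v` (Gram matrix `weilWindowSesq a χ_m χ_n`, abstract) and prove
`weilPositivityOn_of_real_gram_psd` under the hypothesis `hreal` that the Gram entries are real; weil-2's
`WeilFormatCEntry*.lean` compute the QUADRATIC form in closed form (Yoshida (5.15)/(5.16), `Yoshida1992.gramCoeff`).
This file identifies the two ENTRY-WISE (weil-3 FORMATC-LEAN-MAP "the one consistency item"):

* `weilPoleSesq_chi`: `weilPoleSesq χ_m χ_n = polarCoeff a m n`;
* `weilIncrementSesq_chi` / `_of_le`: `weilIncrementSesq χ_m χ_n t = incrCoeff a t m n` (`0 ≤ t ≤ 2a`), `= 2δ_{mn}` (`t ≥ 2a`);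
* `setIntegral_weilArchDensity_mul_weilIncrementSesq_chi`: the archimedean entry as the real window/tail integrals
  of `WeilFormatCEntryArchSeries.lean`;
* **`weilWindowSesq_chi`: `weilWindowSesq a χ_m χ_n = (gramCoeff a m n : ℂ)`** — real (`weilWindowSesq_chi_im`), with
  real part Yoshida's coefficient (`weilWindowSesq_chi_re`);
* `weilPositivityOn_of_gramCoeff_psd`: ∀N, real PSD of `(gramCoeff a m n)_{|m|,|n|≤N}` ⇒ `WeilPositivityOn a`.

References: H. Yoshida, Adv. Stud. Pure Math. 21 (1992) 281–325, §5 (5.15)/(5.16) [Yoshida1992HermitianForms].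
-/

set_option linter.dupNamespace false

noncomputable section

open Complex Set MeasureTheory Finset
open scoped Real ComplexConjugate BigOperators ArithmeticFunction.vonMangoldt

namespace Summit.RiemannHypothesis.RiemannHypothesis.Theorems.WeilFormatC

open Literature.NumberTheory.LFunctions Literature.NumberTheory.LFunctions.Yoshida1992
  Literature.Analysis.SpecialFunctions

/-! ## Entry-wise closed forms of weil-3's sesquilinear window form on the `χ`-basis -/

/-- The polar coefficient from the two polar integrals:
`2 C_m C_n − 2 S_m S_n = polarCoeff a m n` (`C`, `S` the real cosh / sinh integrals of `χ`). -/
theorem two_mul_polar_integrals_eq_polarCoeff {a : ℝ} (ha : 0 < a) (m n : ℤ) :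
    2 * ((-1 : ℝ) ^ m * (2 * (Real.exp (a / 2) - Real.exp (-(a / 2)))) / (Real.sqrt (2 * a) * (1 + 4 * (π * m / a) ^ 2)) *
        ((-1 : ℝ) ^ n * (2 * (Real.exp (a / 2) - Real.exp (-(a / 2)))) / (Real.sqrt (2 * a) * (1 + 4 * (π * n / a) ^ 2)))) -
      2 * ((-((-1 : ℝ) ^ m * (4 * (π * m / a) * (Real.exp (a / 2) - Real.exp (-(a / 2))))) /
          (Real.sqrt (2 * a) * (1 + 4 * (π * m / a) ^ 2))) *
        (-((-1 : ℝ) ^ n * (4 * (π * n / a) * (Real.exp (a / 2) - Real.exp (-(a / 2))))) /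
          (Real.sqrt (2 * a) * (1 + 4 * (π * n / a) ^ 2)))) = polarCoeff a m n := by
  unfold polarCoeff freq
  have hsq : a = Real.sqrt (2 * a) ^ 2 / 2 := by
    rw [Real.sq_sqrt (by positivity)]; ring
  have hq : 0 < Real.sqrt (2 * a) := Real.sqrt_pos.2 (by positivity)
  generalize Real.sqrt (2 * a) = q at hsq hq ⊢
  subst hsq
  have hq' : q ≠ 0 := hq.ne'
  have hm' : (1 + 4 * (π * m / (q ^ 2 / 2)) ^ 2) ≠ 0 := by positivity
  have hn' : (1 + 4 * (π * n / (q ^ 2 / 2)) ^ 2) ≠ 0 := by positivity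
  rw [zpow_add₀ (by norm_num : (-1 : ℝ) ≠ 0)]
  field_simp
  ring

/-- **Pole entry**: `weilPoleSesq χ_m χ_n = polarCoeff a m n` (`a > 0`). -/
theorem weilPoleSesq_chi {a : ℝ} (ha : 0 < a) (m n : ℤ) :
    weilPoleSesq (chi a m) (chi a n) = (polarCoeff a m n : ℂ) := by
  rw [weilPoleSesq, integral_chi_mul_cosh ha, integral_chi_mul_cosh ha, integral_chi_mul_sinh ha,
    integral_chi_mul_sinh ha, ← two_mul_polar_integrals_eq_polarCoeff ha m n]
  set Cm : ℝ := (-1 : ℝ) ^ m * (2 * (Real.exp (a / 2) - Real.exp (-(a / 2)))) / (Real.sqrt (2 * a) * (1 + 4 * (π * m / a) ^ 2))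
  set Cn : ℝ := (-1 : ℝ) ^ n * (2 * (Real.exp (a / 2) - Real.exp (-(a / 2)))) / (Real.sqrt (2 * a) * (1 + 4 * (π * n / a) ^ 2))
  set Sm : ℝ := -((-1 : ℝ) ^ m * (4 * (π * m / a) * (Real.exp (a / 2) - Real.exp (-(a / 2))))) /
    (Real.sqrt (2 * a) * (1 + 4 * (π * m / a) ^ 2))
  set Sn : ℝ := -((-1 : ℝ) ^ n * (4 * (π * n / a) * (Real.exp (a / 2) - Real.exp (-(a / 2))))) /
    (Real.sqrt (2 * a) * (1 + 4 * (π * n / a) ^ 2))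
  simp only [map_mul, Complex.conj_ofReal, Complex.conj_I]
  push_cast
  linear_combination (2 * (Sm : ℂ) * Sn) * Complex.I_sq

/-- **Increment entry on the window scale**: `weilIncrementSesq χ_m χ_n t = incrCoeff a t m n` for `0 ≤ t ≤ 2a`. -/
theorem weilIncrementSesq_chi {a : ℝ} (ha : 0 < a) (m n : ℤ) {t : ℝ} (ht0 : 0 ≤ t) (ht : t ≤ 2 * a) :
    weilIncrementSesq (chi a m) (chi a n) t = (incrCoeff a t m n : ℂ) := by
  rw [weilIncrementSesq, integral_incr_mul_conj_incr_eq ha m n ht0 ht, incrCoeff_comm]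
  rfl

/-- **Increment entry beyond the window**: `weilIncrementSesq χ_m χ_n t = 2δ_{mn}` for `t ≥ 2a`. -/
theorem weilIncrementSesq_chi_of_le {a : ℝ} (ha : 0 < a) (m n : ℤ) {t : ℝ} (ht : 2 * a ≤ t) :
    weilIncrementSesq (chi a m) (chi a n) t = ((if m = n then 2 else 0 : ℝ) : ℂ) := by
  rw [weilIncrementSesq, integral_incr_mul_conj_incr ha m n (by linarith), integral_chi_shift_mul_conj_chi_of_le ha m n ht,
    integral_chi_shift_mul_conj_chi_of_le ha n m ht, map_zero, sub_zero, sub_zero]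
  by_cases h : m = n
  · simp [h]
  · simp [h]

/-- The archimedean integrand of the sesquilinear energy on the `χ`-basis is the real kernel of the block file:
on `(0, ∞)`, `ρ(t)·weilIncrementSesq χ_m χ_n t = ρ(t) K_t(m,n)` on `(0,2a]` and `= 2ρ(t)δ_{mn}` beyond. -/
theorem setIntegral_weilArchDensity_mul_weilIncrementSesq_chi {a : ℝ} (ha : 0 < a) (m n : ℤ) :
    ∫ t in Ioi (0 : ℝ), (weilArchDensity t : ℂ) * weilIncrementSesq (chi a m) (chi a n) t =
      (((if m = n then
          (∫ t in Ioc 0 (2 * a), weilArchDensity t * (2 - 2 * (1 - t / (2 * a)) * Real.cos (π * m / a * t))) +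
            ∫ t in Ioi (2 * a), weilArchDensity t * 2
         else -(-1 : ℝ) ^ (m + n) / (π * (m - n)) *
          ((∫ t in Ioc 0 (2 * a), weilArchDensity t * Real.sin (π * n / a * t)) -
            ∫ t in Ioc 0 (2 * a), weilArchDensity t * Real.sin (π * m / a * t))) : ℝ) : ℂ) := by
  have hT : (0 : ℝ) < 2 * a := by positivity
  -- the integrand is real: `ρ · K̃` with `K̃ = K_t(m,n)` on `(0,2a]`, `2δ` beyond
  set K : ℝ → ℝ := fun t ↦ if t ≤ 2 * a then incrCoeff a t m n else (if m = n then 2 else 0) with hK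
  have hEq : EqOn (fun t ↦ (weilArchDensity t : ℂ) * weilIncrementSesq (chi a m) (chi a n) t)
      (fun t ↦ ((weilArchDensity t * K t : ℝ) : ℂ)) (Ioi 0) := by
    intro t ht
    simp only [hK]
    by_cases h2 : t ≤ 2 * a
    · rw [if_pos h2, weilIncrementSesq_chi ha m n (le_of_lt ht) h2]; push_cast; ring
    · rw [if_neg h2, weilIncrementSesq_chi_of_le ha m n (not_le.1 h2).le]; push_cast; ring
  rw [setIntegral_congr_fun measurableSet_Ioi hEq, integral_complex_ofReal]
  congr 1
  -- split `(0,∞) = (0,2a] ∪ (2a,∞)`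
  have hK1 : EqOn (fun t ↦ weilArchDensity t * K t) (fun t ↦ weilArchDensity t * incrCoeff a t m n) (Ioc 0 (2 * a)) :=
    fun t ht ↦ by simp only [hK, if_pos ht.2]
  have hK2 : EqOn (fun t ↦ weilArchDensity t * K t) (fun t ↦ weilArchDensity t * (if m = n then 2 else 0))
      (Ioi (2 * a)) := fun t ht ↦ by simp only [hK, if_neg (not_le.2 (Set.mem_Ioi.1 ht))]
  have i1 : IntegrableOn (fun t ↦ weilArchDensity t * K t) (Ioc 0 (2 * a)) := by
    refine IntegrableOn.congr_fun ?_ hK1.symm measurableSet_Ioc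
    have h := integrableOn_weilArchDensity_mul_kernel ha m n
    refine h.congr_fun (fun t _ ↦ ?_) measurableSet_Ioc
    simp only [incrCoeff, freq]
  have i2 : IntegrableOn (fun t ↦ weilArchDensity t * K t) (Ioi (2 * a)) :=
    IntegrableOn.congr_fun ((integrableOn_weilArchDensity_Ioi hT).mul_const _) hK2.symm measurableSet_Ioi
  rw [← Ioc_union_Ioi_eq_Ioi hT.le, setIntegral_union Ioc_disjoint_Ioi_same measurableSet_Ioi i1 i2,
    setIntegral_congr_fun measurableSet_Ioc hK1, setIntegral_congr_fun measurableSet_Ioi hK2]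
  by_cases h : m = n
  · subst h
    simp only [if_true, incrCoeff, freq]
  · simp only [if_neg h, mul_zero, MeasureTheory.integral_zero, add_zero, incrCoeff, freq]
    have hfun : (fun t : ℝ ↦ weilArchDensity t *
        (-(-1 : ℝ) ^ (m + n) * (Real.sin (π * n / a * t) - Real.sin (π * m / a * t)) / (π * (m - n)))) =
        fun t ↦ (-(-1 : ℝ) ^ (m + n) / (π * (m - n))) *
          (weilArchDensity t * Real.sin (π * n / a * t) - weilArchDensity t * Real.sin (π * m / a * t)) := by
      funext t; ring
    rw [hfun, MeasureTheory.integral_const_mul,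
      integral_sub (integrableOn_weilArchDensity_mul_sin ha n) (integrableOn_weilArchDensity_mul_sin ha m)]

/-- **THE BRIDGE between the two Gram packagings**: weil-3's sesquilinear Gram entry IS Yoshida's coefficient,
`weilWindowSesq a χ_m χ_n = gramCoeff a m n` (`a > 0`; in particular real — the `hreal` hypothesis of
`weilPositivityOn_of_real_gram_psd` / `…_sector_psd` holds). -/
theorem weilWindowSesq_chi {a : ℝ} (ha : 0 < a) (m n : ℤ) :
    weilWindowSesq a (chi a m) (chi a n) = (gramCoeff a m n : ℂ) := by
  rw [weilWindowSesq_eq, weilPoleSesq_chi ha, setIntegral_weilArchDensity_mul_weilIncrementSesq_chi ha,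
    integral_chi_mul_conj_chi ha, weilMarkovConstant_eq]
  have hk : ∀ k ∈ weilPrimeIndex a, 0 ≤ Real.log k ∧ Real.log k ≤ 2 * a := fun k hk ↦
    ⟨Real.log_natCast_nonneg k, (mem_weilPrimeIndex.1 hk).le⟩
  rw [Finset.sum_congr rfl fun k hk' ↦ by rw [weilIncrementSesq_chi ha m n (hk k hk').1 (hk k hk').2]]
  rw [gramCoeff, primeCoeff, archCoeff]
  have h0 := reDigammaQuarter_zero_eq
  have h4 := log_four_mul_pi
  have hprime : (∑ k ∈ weilPrimeIndex a, (Λ k : ℝ) / Real.sqrt k * (incrCoeff a (Real.log k) m n - if m = n then 2 else 0)) =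
      (∑ k ∈ weilPrimeIndex a, (Λ k : ℝ) / Real.sqrt k * incrCoeff a (Real.log k) m n) -
        (if m = n then 2 else 0) * ∑ k ∈ weilPrimeIndex a, (Λ k : ℝ) / Real.sqrt k := by
    rw [Finset.mul_sum, ← Finset.sum_sub_distrib]
    refine Finset.sum_congr rfl fun k _ ↦ ?_
    ring
  rw [hprime]
  by_cases h : m = n
  · subst h
    simp only [if_true]
    rw [setIntegral_weilArchDensity_mul_diag ha m, h0, h4]
    simp only [archExpSumDiag, freq]
    push_cast
    ring
  · simp only [if_neg h]
    rw [setIntegral_weilArchDensity_mul_sin ha n, setIntegral_weilArchDensity_mul_sin ha m]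
    simp only [archExpSumSin, freq]
    push_cast
    ring

/-- Realness of the Gram entries (discharges `hreal` in weil-3's `weilPositivityOn_of_real_gram_psd`). -/
theorem weilWindowSesq_chi_im {a : ℝ} (ha : 0 < a) (m n : ℤ) : (weilWindowSesq a (chi a m) (chi a n)).im = 0 := by
  rw [weilWindowSesq_chi ha, Complex.ofReal_im]

/-- The real part is Yoshida's coefficient. -/
theorem weilWindowSesq_chi_re {a : ℝ} (ha : 0 < a) (m n : ℤ) : (weilWindowSesq a (chi a m) (chi a n)).re = gramCoeff a m n := by
  rw [weilWindowSesq_chi ha, Complex.ofReal_re]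

/-! ## Consequence: weil-3's real-Gram route with the explicit matrix -/

/-- **Format C, end to end (unsectorised form).**  If for every `N` the real symmetric matrix
`(gramCoeff a m n)_{|m|,|n| ≤ N}` — Yoshida's (5.15)/(5.16) — is positive semidefinite as a real quadratic form,
then `WeilPositivityOn a` (`a > 0`): weil-3's `weilPositivityOn_of_real_gram_psd` with its Gram matrix identified
(`weilWindowSesq_chi`) and `hreal` discharged. (Sectorised form: `weilPositivityOn_of_gramCoeff_sector_psd`,
`WeilFormatCEntryGram.lean`.) -/
theorem weilPositivityOn_of_gramCoeff_psd {a : ℝ} (ha : 0 < a)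
    (hpsd : ∀ (N : ℕ) (x : ℤ → ℝ), 0 ≤ ∑ m ∈ modes N, ∑ n ∈ modes N, x m * x n * gramCoeff a m n) :
    WeilPositivityOn a :=
  weilPositivityOn_of_real_gram_psd ha (weilWindowSesq_chi_im ha) fun N x ↦ by
    simpa only [weilWindowSesq_chi_re ha] using hpsd N x

end Summit.RiemannHypothesis.RiemannHypothesis.Theorems.WeilFormatC
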